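import Summits.CriticalPhenomena.PercolationContinuityZ3.Theorems.Transplant.FKConnectivityAllQAntipodalAndGenWeightPath
import Summits.CriticalPhenomena.PercolationContinuityZ3.Theorems.Transplant.FKConnectivityAllQAntipodalQfree
import HarnessLib

/-!
# Connectivity correlation inequalities for `φ_{w,q}`, every `q > 0` — file 32dW: **CONJECTURE AND⁺ IS A THEOREM** — the `q`-free (level)
# form of `C_∞` for the AND type, in every cell: `Z_H(z,q)² Cov_{φ_{z,q}}(∏_{e∈S} ω_e, g) ∈ (q − 1)·ℝ≥0[z, q]` on series–parallel graphs

Support file (`--supports stmt-CriticalPhenomena-4575`), FK sub-lane `prim-bschramm-fk-2` (gen 21); builds on p205010 (kernel theorem,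
internal audit signed; external expert review pending).  No definitions, no named facts, no sorries; standard axioms.

Gen 17 (FK-Q2 §26) conjectured, on 4.7·10⁶ exact cells and later through 11 edges, that the AND-drift polynomial `a_S(q)` of every edge set
`S` of a 2-connected series–parallel graph, divided by `q − 1`, has NONNEGATIVE coefficients (Conjecture AND⁺), and reduced it to a word-Hall
statement WH(G,S).  Gen 19 proved the `q`-summed statement (`FK.apPsiC_and_nonpos_of_isTTSP`, the master AND theorem) by junction
identities.  Gen 21 observed that those identities are exponent-matching identities of signed monomials, hence hold for every level weight,
and re-ran the induction with ANTITONE weights (files 32W, 32aW, 32bW, 32cW).  This file draws the conclusion: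
* `FK.apPsiCW_andInd_eq` — the contracted bridge of file 29 for an arbitrary level weight;
* **`FK.apPsiCW_and_nonpos_of_isTTSP`** — `E` TTSP between `s, t`, `st ∉ E`, `N, T, C ⊆ E` pairwise disjoint, `S = T ∪ {st}`, `w` antitone,
  `g` increasing and not reading `S` ⟹ `∑_{γ ⊆ N ∪ S} w(k(γ∪C)+k(((N∪S)\γ)∪C)) (1_{S⊆γ∪C} − 1_{S⊆((N∪S)\γ)∪C})(g(γ∪C) − g(((N∪S)\γ)∪C)) ≤ 0`;
* **`FK.apPsiC_levels_le_and_nonpos_of_isTTSP`** — the partial sums over `{γ : k(γ∪C)+k(((N∪S)\γ)∪C) ≤ J}` are `≤ 0` for every `J`: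
  EVERY COEFFICIENT, in the edge odds `z` AND in the cluster weight `q`, of `Z_H(z,q)² Cov_{φ_{z,q}}(∏_{e∈S} ω_e, g) / (q − 1)` is nonnegative,
  for EVERY edge set `S` of EVERY 2-connected series–parallel graph `H` and every increasing `g` off `S` — Conjecture AND⁺, and gen 21's
  Conjecture C_∞⁺ (memo FROM-fk-2-g21-QFREE, FK-Q2 §30) for the AND type.  Summed against `q^J(1 − q)` it returns the master AND theorem.
[cite: Grimmett2006, §1.4 eq. (1.20) (p. 15); §3.8 Thm. (3.90) (pp. 61–62); §3.9 (pp. 63–64)] [cite: Wagner2006, Thm. 5.8(d), §5.3]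
-/

noncomputable section

namespace Summit.CriticalPhenomena.PercolationContinuityZ3.Theorems

namespace FK

open SimpleGraph Literature.Probability.LatticeModels Literature.Probability.Percolation
open scoped Classical

variable {V : Type*} [Fintype V]

section AndPlus

omit [Fintype V] in
/-- **Contracted bridge, weighted.**  For `S` nonempty, disjoint from `N` and from `C`, `g` not reading `S`, and any `w`:
`∑_{γ ⊆ N∪S} w(k(γ∪C)+k(((N∪S)\γ)∪C)) (1_{S⊆γ∪C} − 1_{S⊆((N∪S)\γ)∪C})(g(γ∪C) − g(((N∪S)\γ)∪C))
 = 2 ∑_{γ ⊆ N} (w(k(γ∪S∪C)+k((N\γ)∪C)) − w(k((N\γ)∪S∪C)+k(γ∪C))) g(γ∪C)`. [cite: Grimmett2006, §1.4 eq. (1.20) (p. 15); §3.8 (pp. 61–62)] -/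
theorem apPsiCW_andInd_eq (w : ℕ → ℝ) {N S C : Finset (Sym2 V)} (hNS : Disjoint N S) (hS : S.Nonempty) (hSC : Disjoint S C)
    {g : Finset (Sym2 V) → ℝ} (hg : ∀ A T : Finset (Sym2 V), T ⊆ S → g (A ∪ T) = g A) :
    ∑ γ ∈ (N ∪ S).powerset, w (apExpC (N ∪ S) C γ) *
        (((if S ⊆ γ ∪ C then (1 : ℝ) else 0) - (if S ⊆ (N ∪ S) \ γ ∪ C then 1 else 0)) * (g (γ ∪ C) - g ((N ∪ S) \ γ ∪ C))) =
      2 * ∑ γ ∈ N.powerset, (w (clusterCount (↑(γ ∪ S ∪ C) : BondConfig V) ∅ + clusterCount (↑(N \ γ ∪ C) : BondConfig V) ∅) -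
        w (clusterCount (↑(N \ γ ∪ S ∪ C) : BondConfig V) ∅ + clusterCount (↑(γ ∪ C) : BondConfig V) ∅)) * g (γ ∪ C) := by
  rw [sum_powerset_union_disj hNS]
  have hS0 : S ≠ ∅ := Finset.nonempty_iff_ne_empty.1 hS
  have hSsub : ∀ X : Finset (Sym2 V), Disjoint X S → ¬ S ⊆ X ∪ C := by
    intro X hX h
    obtain ⟨e, he⟩ := hS
    rcases Finset.mem_union.1 (h he) with h' | h'
    · exact Finset.disjoint_right.1 hX he h'
    · exact Finset.disjoint_left.1 hSC he h'
  have inner : ∀ γ ∈ N.powerset,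
      ∑ ε ∈ S.powerset, w (apExpC (N ∪ S) C (γ ∪ ε)) *
          (((if S ⊆ γ ∪ ε ∪ C then (1 : ℝ) else 0) - (if S ⊆ (N ∪ S) \ (γ ∪ ε) ∪ C then 1 else 0)) *
            (g (γ ∪ ε ∪ C) - g ((N ∪ S) \ (γ ∪ ε) ∪ C))) =
        (w (clusterCount (↑(γ ∪ S ∪ C) : BondConfig V) ∅ + clusterCount (↑(N \ γ ∪ C) : BondConfig V) ∅) -
            w (clusterCount (↑(N \ γ ∪ S ∪ C) : BondConfig V) ∅ + clusterCount (↑(γ ∪ C) : BondConfig V) ∅)) *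
          (g (γ ∪ C) - g (N \ γ ∪ C)) := by
    intro γ hγ
    rw [Finset.mem_powerset] at hγ
    have hγS : Disjoint γ S := Finset.disjoint_of_subset_left hγ hNS
    have hcS : Disjoint (N \ γ) S := Finset.disjoint_of_subset_left Finset.sdiff_subset hNS
    rw [Finset.sum_eq_add_of_mem S ∅ (Finset.mem_powerset.2 le_rfl) (Finset.mem_powerset.2 (Finset.empty_subset _)) hS0 ?_]
    · simp only [Finset.union_empty]
      have c1 : (N ∪ S) \ (γ ∪ S) = N \ γ := by
        rw [union_sdiff_union hNS hγ le_rfl, sdiff_self, Finset.bot_eq_empty, Finset.union_empty]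
      have c2 : (N ∪ S) \ γ = N \ γ ∪ S := by
        rw [Finset.union_sdiff_distrib, hγS.symm.sdiff_eq_left]
      have t1 : S ⊆ γ ∪ S ∪ C := fun e he => Finset.mem_union_left _ (Finset.mem_union_right _ he)
      have t2 : ¬ S ⊆ N \ γ ∪ C := hSsub _ hcS
      have t3 : ¬ S ⊆ γ ∪ C := hSsub _ hγS
      have t4 : S ⊆ N \ γ ∪ S ∪ C := fun e he => Finset.mem_union_left _ (Finset.mem_union_right _ he)
      have g1 : g (γ ∪ S ∪ C) = g (γ ∪ C) := by rw [Finset.union_right_comm, hg _ S le_rfl]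
      have g2 : g (N \ γ ∪ S ∪ C) = g (N \ γ ∪ C) := by rw [Finset.union_right_comm, hg _ S le_rfl]
      rw [c1, c2, if_pos t1, if_neg t2, if_neg t3, if_pos t4, g1, g2]
      unfold apExpC
      rw [c1, c2, add_comm (clusterCount (↑(γ ∪ C) : BondConfig V) ∅)]
      ring
    · intro ε hε hne
      rw [Finset.mem_powerset] at hε
      have n1 : ¬ S ⊆ γ ∪ ε ∪ C := fun h => hne.1 (le_antisymm hε fun e he => by
        rcases Finset.mem_union.1 (h he) with h' | h'
        · rcases Finset.mem_union.1 h' with h'' | h''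
          · exact (Finset.disjoint_left.1 hγS h'' he).elim
          · exact h''
        · exact (Finset.disjoint_left.1 hSC he h').elim)
      have n2 : ¬ S ⊆ (N ∪ S) \ (γ ∪ ε) ∪ C := fun h => hne.2 (Finset.eq_empty_of_forall_notMem fun e he => by
        rcases Finset.mem_union.1 (h (hε he)) with h' | h'
        · exact (Finset.mem_sdiff.1 h').2 (Finset.mem_union_right _ he)
        · exact Finset.disjoint_left.1 hSC (hε he) h')
      rw [if_neg n1, if_neg n2, sub_self, zero_mul, mul_zero]
  rw [Finset.sum_congr rfl inner]
  have flip := sum_powerset_flip N (fun γ =>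
    (w (clusterCount (↑(γ ∪ S ∪ C) : BondConfig V) ∅ + clusterCount (↑(N \ γ ∪ C) : BondConfig V) ∅) -
        w (clusterCount (↑(N \ γ ∪ S ∪ C) : BondConfig V) ∅ + clusterCount (↑(γ ∪ C) : BondConfig V) ∅)) * g (N \ γ ∪ C))
  have flip' : ∑ γ ∈ N.powerset, (w (clusterCount (↑(γ ∪ S ∪ C) : BondConfig V) ∅ + clusterCount (↑(N \ γ ∪ C) : BondConfig V) ∅) -
        w (clusterCount (↑(N \ γ ∪ S ∪ C) : BondConfig V) ∅ + clusterCount (↑(γ ∪ C) : BondConfig V) ∅)) * g (N \ γ ∪ C) =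
      - ∑ γ ∈ N.powerset, (w (clusterCount (↑(γ ∪ S ∪ C) : BondConfig V) ∅ + clusterCount (↑(N \ γ ∪ C) : BondConfig V) ∅) -
        w (clusterCount (↑(N \ γ ∪ S ∪ C) : BondConfig V) ∅ + clusterCount (↑(γ ∪ C) : BondConfig V) ∅)) * g (γ ∪ C) := by
    rw [flip, ← Finset.sum_neg_distrib]
    refine Finset.sum_congr rfl fun γ hγ => ?_
    rw [Finset.mem_powerset] at hγ
    rw [Finset.sdiff_sdiff_eq_self hγ]
    ring
  have split : ∑ γ ∈ N.powerset, (w (clusterCount (↑(γ ∪ S ∪ C) : BondConfig V) ∅ + clusterCount (↑(N \ γ ∪ C) : BondConfig V) ∅) -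
        w (clusterCount (↑(N \ γ ∪ S ∪ C) : BondConfig V) ∅ + clusterCount (↑(γ ∪ C) : BondConfig V) ∅)) *
          (g (γ ∪ C) - g (N \ γ ∪ C)) =
      ∑ γ ∈ N.powerset, (w (clusterCount (↑(γ ∪ S ∪ C) : BondConfig V) ∅ + clusterCount (↑(N \ γ ∪ C) : BondConfig V) ∅) -
        w (clusterCount (↑(N \ γ ∪ S ∪ C) : BondConfig V) ∅ + clusterCount (↑(γ ∪ C) : BondConfig V) ∅)) * g (γ ∪ C) -
        ∑ γ ∈ N.powerset, (w (clusterCount (↑(γ ∪ S ∪ C) : BondConfig V) ∅ + clusterCount (↑(N \ γ ∪ C) : BondConfig V) ∅) -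
        w (clusterCount (↑(N \ γ ∪ S ∪ C) : BondConfig V) ∅ + clusterCount (↑(γ ∪ C) : BondConfig V) ∅)) * g (N \ γ ∪ C) := by
    rw [← Finset.sum_sub_distrib]; refine Finset.sum_congr rfl fun γ _ => ?_; ring
  rw [split, flip']
  ring

/-- **THEOREM (Conjecture AND⁺ — the `q`-free AND theorem, every cell, every antitone weight).**  `E` TTSP between `s, t`, `st ∉ E`
(`H = E ∪ {st}` an arbitrary 2-connected series–parallel graph presented from one of its edges), `N, T, C ⊆ E` pairwise disjoint, `S = T ∪ {st}`,
`w` antitone, `g` increasing and not reading `S` ⟹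
`∑_{γ ⊆ N∪S} w(k(γ∪C)+k(((N∪S)\γ)∪C)) (1_{S⊆γ∪C} − 1_{S⊆((N∪S)\γ)∪C})(g(γ∪C) − g(((N∪S)\γ)∪C)) ≤ 0`.
[cite: Grimmett2006, §3.8 Thm. (3.90) (pp. 61–62); §3.9 (pp. 63–64)] [cite: Wagner2006, Thm. 5.8(d), §5.3] -/
theorem apPsiCW_and_nonpos_of_isTTSP {E : Finset (Sym2 V)} {s t : V}
    (hE : IsTTSP E s t) (hst : s(s, t) ∉ E) {N T C : Finset (Sym2 V)} (hN : N ⊆ E) (hT : T ⊆ E) (hC : C ⊆ E)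
    (hNT : Disjoint N T) (hNC : Disjoint N C) (hTC : Disjoint T C) {w : ℕ → ℝ} (hw : ∀ n : ℕ, w (n + 1) ≤ w n)
    {g : Finset (Sym2 V) → ℝ} (hg : ∀ A U : Finset (Sym2 V), U ⊆ insert s(s, t) T → g (A ∪ U) = g A)
    (hmono : ∀ ⦃X Y : Finset (Sym2 V)⦄, X ⊆ Y → g X ≤ g Y) :
    ∑ γ ∈ (N ∪ insert s(s, t) T).powerset, w (apExpC (N ∪ insert s(s, t) T) C γ) *
        (((if insert s(s, t) T ⊆ γ ∪ C then (1 : ℝ) else 0) - (if insert s(s, t) T ⊆ (N ∪ insert s(s, t) T) \ γ ∪ C then 1 else 0)) *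
          (g (γ ∪ C) - g ((N ∪ insert s(s, t) T) \ γ ∪ C))) ≤ 0 := by
  have hNS : Disjoint N (insert s(s, t) T) := Finset.disjoint_insert_right.2 ⟨fun h => hst (hN h), hNT⟩
  have hSC : Disjoint (insert s(s, t) T) C := Finset.disjoint_insert_left.2 ⟨fun h => hst (hC h), hTC⟩
  rw [apPsiCW_andInd_eq w hNS ⟨s(s, t), Finset.mem_insert_self _ _⟩ hSC hg]
  have main := andGenW_drift_nonpos_of_isTTSP E.card le_rfl hE hst hN (A := T ∪ C) (C := C) (Finset.union_subset hT hC)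
    Finset.subset_union_right (Finset.disjoint_union_right.2 ⟨hNT, hNC⟩) w hw (fun γ => g (γ ∪ C))
    (fun X Y hXY _ => hmono (Finset.union_subset_union hXY le_rfl))
  have hsum : ∑ γ ∈ N.powerset, (w (clusterCount (↑(γ ∪ insert s(s, t) T ∪ C) : BondConfig V) ∅ + clusterCount (↑(N \ γ ∪ C) : BondConfig V) ∅) -
        w (clusterCount (↑(N \ γ ∪ insert s(s, t) T ∪ C) : BondConfig V) ∅ + clusterCount (↑(γ ∪ C) : BondConfig V) ∅)) * g (γ ∪ C) =
      ∑ γ ∈ N.powerset, (w (clusterCount (↑(insert s(s, t) (γ ∪ (T ∪ C))) : BondConfig V) ∅ + clusterCount (↑(N \ γ ∪ C) : BondConfig V) ∅) -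
        w (clusterCount (↑(insert s(s, t) (N \ γ ∪ (T ∪ C))) : BondConfig V) ∅ + clusterCount (↑(γ ∪ C) : BondConfig V) ∅)) * g (γ ∪ C) := by
    refine Finset.sum_congr rfl fun γ _ => ?_
    rw [union_insert_union_eq, union_insert_union_eq]
  rw [hsum]
  linarith

/-- **COROLLARY (AND⁺, partial sums): every coefficient — in the edge odds AND in `q` — of `Z_H(z,q)² Cov_{φ_{z,q}}(∏_{e∈S} ω_e, g)/(q−1)` is
nonnegative.**  Under the hypotheses of `FK.apPsiCW_and_nonpos_of_isTTSP` (no weight), for every level cut-off `J`: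
`∑_{γ ⊆ N∪S : k(γ∪C)+k(((N∪S)\γ)∪C) ≤ J} (1_{S⊆γ∪C} − 1_{S⊆((N∪S)\γ)∪C})(g(γ∪C) − g(((N∪S)\γ)∪C)) ≤ 0` — the partial sums of the summands of
`apPsiC q (N ∪ S) C 1_{S ⊆ ·} g` by cluster level.  With `…AntipodalQfree`'s Abel bridge this re-proves gen 19's master AND theorem for
`0 ≤ q ≤ 1`; as stated it is gen 17's Conjecture AND⁺ for every edge set `S` of every 2-connected series–parallel graph, in every cell.
[cite: Grimmett2006, §3.8 Thm. (3.90) (pp. 61–62); §3.9 (pp. 63–64)] [cite: Wagner2006, Thm. 5.8(d), §5.3] -/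
theorem apPsiC_levels_le_and_nonpos_of_isTTSP {E : Finset (Sym2 V)} {s t : V}
    (hE : IsTTSP E s t) (hst : s(s, t) ∉ E) {N T C : Finset (Sym2 V)} (hN : N ⊆ E) (hT : T ⊆ E) (hC : C ⊆ E)
    (hNT : Disjoint N T) (hNC : Disjoint N C) (hTC : Disjoint T C) (J : ℕ)
    {g : Finset (Sym2 V) → ℝ} (hg : ∀ A U : Finset (Sym2 V), U ⊆ insert s(s, t) T → g (A ∪ U) = g A)
    (hmono : ∀ ⦃X Y : Finset (Sym2 V)⦄, X ⊆ Y → g X ≤ g Y) :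
    ∑ γ ∈ (N ∪ insert s(s, t) T).powerset with apExpC (N ∪ insert s(s, t) T) C γ ≤ J,
        ((if insert s(s, t) T ⊆ γ ∪ C then (1 : ℝ) else 0) - (if insert s(s, t) T ⊆ (N ∪ insert s(s, t) T) \ γ ∪ C then 1 else 0)) *
          (g (γ ∪ C) - g ((N ∪ insert s(s, t) T) \ γ ∪ C)) ≤ 0 := by
  have key := apPsiCW_and_nonpos_of_isTTSP hE hst hN hT hC hNT hNC hTC (w := fun n => if n ≤ J then (1 : ℝ) else 0)
    (fun n => by
      split_ifs with h1 h2 h2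
      · exact le_rfl
      · exact absurd ((Nat.le_succ n).trans h1) h2
      · exact zero_le_one
      · exact le_rfl) hg hmono
  rw [Finset.sum_filter]
  refine le_of_eq_of_le (Finset.sum_congr rfl fun γ _ => ?_) key
  split_ifs <;> ring

/-- **COROLLARY (the master AND theorem recovered for all `0 ≤ q ≤ 1`, every cell, via the Abel bridge).**
[cite: Grimmett2006, §3.8 Thm. (3.90) (pp. 61–62); §3.9 (pp. 63–64)] [cite: Wagner2006, Thm. 5.8(d), §5.3] -/
theorem apPsiC_and_nonpos_of_levels {q : ℝ} (hq0 : 0 ≤ q) (hq1 : q ≤ 1) {E : Finset (Sym2 V)} {s t : V}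
    (hE : IsTTSP E s t) (hst : s(s, t) ∉ E) {N T C : Finset (Sym2 V)} (hN : N ⊆ E) (hT : T ⊆ E) (hC : C ⊆ E)
    (hNT : Disjoint N T) (hNC : Disjoint N C) (hTC : Disjoint T C)
    {g : Finset (Sym2 V) → ℝ} (hg : ∀ A U : Finset (Sym2 V), U ⊆ insert s(s, t) T → g (A ∪ U) = g A)
    (hmono : ∀ ⦃X Y : Finset (Sym2 V)⦄, X ⊆ Y → g X ≤ g Y) :
    apPsiC q (N ∪ insert s(s, t) T) C (fun X => if insert s(s, t) T ⊆ X then 1 else 0) g ≤ 0 :=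
  sum_pow_mul_nonpos_of_levels_le (N ∪ insert s(s, t) T).powerset (apExpC (N ∪ insert s(s, t) T) C)
    (fun γ => ((if insert s(s, t) T ⊆ γ ∪ C then (1 : ℝ) else 0) -
      (if insert s(s, t) T ⊆ (N ∪ insert s(s, t) T) \ γ ∪ C then 1 else 0)) * (g (γ ∪ C) - g ((N ∪ insert s(s, t) T) \ γ ∪ C)))
    hq0 hq1 fun J => apPsiC_levels_le_and_nonpos_of_isTTSP hE hst hN hT hC hNT hNC hTC J hg hmono

end AndPlus

end FK

end Summit.CriticalPhenomena.PercolationContinuityZ3.Theorems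

end
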